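import Literature.MathematicalPhysics.QuantumFieldTheory.Balaban1983to89.B9SectBL2GReadCodedY
import Literature.MathematicalPhysics.QuantumFieldTheory.Balaban1983to89.B9SectBQSizesY
import Literature.MathematicalPhysics.QuantumFieldTheory.Balaban1983to89.B9SectBGClassLettersY

/-!
# `Balaban1983to89.B9SectBQLettersL2Y` — THE `ℓ²` BOND LETTERS OF NODE 00 WITH THE BLOCK VOLUME SYMMETRIZED (LOCATED-15 repair, letters level):
# `QbC2 = conj b (ext ∘ √vol ∘ Q(U))`, `QsbC2 = conj b (Q*(U) ∘ √vol ∘ res)`, `F₂C2`, `F₂sC2`; the PRODUCT IDENTITY `QsbC2·abC·QbC2 = QsbC·abC·QbC`, (3.80) at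
# the new letters, and ★★ their block-`ℓ²` sizes (3.15)∕(3.81) by Schur's test on print's averaging kernels (pub-ymgap N06 row 13, G side, `L²` member)

T. Bałaban, *Propagators for lattice gauge theories in a background field*, Commun. Math. Phys. **99** (1985) 389–434
[`Balaban1985BackgroundPropagators`, "B9"], (3.12)–(3.15) p. 393, (3.24)–(3.26) pp. 394–395, (3.80)–(3.81) p. 407; [4] = T. Bałaban, *Propagators and
renormalization transformations for lattice gauge theories. II*, Commun. Math. Phys. **96** (1984) 223–250 [`Balaban1984PropagatorsII`], (2.19)–(2.20) p. 226,
Prop. 2.6 (2.140) p. 247.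

statement-level skeleton of published theorems with citation tags; proofs where landed; nothing here is a claim about the Yang–Mills mass gap

WHY THIS FILE (seat dag-n06-c gen 14, LOCATED-15).  gen 13's sup letters `QbC = conj b (ext∘Q)`, `QsbC = conj b (Q*·vol∘res)` put the whole block volume on the
`Q*` side; in flat block-`ℓ²` on the fine-bond carrier `QsbC` has size `≈ vol(y′)^{1/2}` from a source at a representative bond, so the factor-wise ℓ² laws of the
L² frames V2–V7 are unsatisfiable at NODE 00.  Print's `Q`, `Q*` are adjoint in the WEIGHTED norms ((Lʲη)^d on 𝔅, η^d on bonds); in flat coordinates the bounded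
pair is `√vol·Q`, `Q*·√vol`.  §1 the letters `QbY2 = ext ∘ diag(√vol) ∘ Q(U)`, `QsbY2 = Q*(U) ∘ diag(√vol) ∘ res` and their conj-`b` images `QbC2`, `QsbC2`,
`F₂C2 = QbC2(U′U) − QbC2(U)`, `F₂sC2`; §2 ★ `qY2_prod` ∕ `qC2_prod` — `QsbY2 ∘ abVY ∘ QbY2 = QsbVY ∘ abVY ∘ QbY` (`√v·(w∕v)·√v = v·(w∕v)`, `res ∘ ext = id`), so the
concrete `Δ_a` is unchanged — and (3.80) `qbC2_prod`, `qsbC2_prod`; §3 ★★ the block-`ℓ²` sizes: `hasL2Majorant_QbC2`, `hasL2Majorant_QsbC2` (constant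
`c_L·√(2L^{d+1})·e^{δ(ℓ+3)}`: rows of the averaging kernel sum to `1` (`sum_abs_qK_eq_one`), volume-weighted columns to `≦ 2L^{d+1}` (`sum_abs_qsK_le`,
`volY_le_of_qK_ne_zero`), transports contractive, stencil within `ℓ + 3` of the block), `hasL2Majorant_F₂C2`, `hasL2Majorant_F₂sC2` (the same with the
variation law `VarParBY`, constant `× c_Var·α₁`).

HONEST SCOPE.  Finite-dimensional bookkeeping over NODE 00's DEFINED averaging operators (def-Y's `QY`, `QsY`, `qK`, `volY`) and the displayed variation law
`VarParBY`; no estimate of [B9] asserted.  COUNT-NEUTRAL; N06 NOT discharged; nothing continuum ∕ OS ∕ mass-gap ∕ Clay.  Cell `pub-ymgap` (HUMAN RULING D-0062),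
Track A node N06 [B9], row 13, 2026-08-29.
-/

noncomputable section

namespace Literature.MathematicalPhysics.QuantumFieldTheory.Balaban1983to89.B9SectBQLettersL2Y

open B6Ineq2142KLevelV1 (β)
open B6GlobalChartV1 (blkV1)
open B6KLevelCensusIndexV1 (KIdx kGeo)
open B6RandomWalk (blockPiece)
open B6RandomWalkL2 (l2n l2n_sq l2n_nonneg HasL2Majorant hasL2Majorant_mono)
open B9Thm34Ext (toB6)
open B9GeoNormsKLevelV1 (geo9K geo9K_l2Norm_nonneg)
open B9GeoLemma21KLevelV1 (geo9K_dist_comm geo9K_len_pos)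
open B9Eq39Adjoint (R)
open B9Eq352DivFormLetters (conj)
open B9PinMembersKLevelV1 (MemberY geo9Y bg9Y)
open B9Eq360DeltaPrimeAY (blkY AfldY)
open B9SectBGpLettersY (GVal decY decY_base decY_prod blkC)
open B9SectBCodedCarrier (CCfg)
open B9SectBGWordDeltaAY (bondOpCoordsRY bondOpCoordsRY_apply restrictScalars_bondOpCoordsY restrictScalars_mul' volY volY_pos abVY QsbVY QbC QsbC abC F₂C F₂sC)
open B9SectBGReadCodedY (bondOpCoordsRY_mul)
open B9SectBQSizesY (volY_le_of_qK_ne_zero bondFunCoordsY_symm_liftY norm_real_smul_le one_le_exp_mul_exp_neg)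
open B9Eq360Vprime (norm_R_le_of_unit)
open B9SectBGClassLettersY (VarParBY)
open B9SectBL2GReadY (indB indB_nonneg_le_one hasL2Majorant_conjB_of_indBound l2NormB_eq l2OfYB_eq_l2n)
open B9SectBL2GReadCodedY (hasL2Majorant_conj_bondOpCoordsRY)
open B9Eq3132Ineq2142Covariant (qK_apply)
open B9Thm310CommutatorBound389B (sum_abs_qsK_le)
open B9Eq3104CommutatorSizesAvg (sum_abs_qK_eq_one)
open Node00 (SiteY BlkY FBondY IBondY CfgY BondParY liftY liftY_apply l2OfY qK qsK qT QY QsY QbY qsK_eq_transpose trLiftY_apply liftMatY liftMatY_apply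
  liftMatY_diagonal_apply extBondY resBondY repBondY repBondY_injective bondCoordsY bondFunCoordsY extBondY_apply_repBondY extBondY_apply_of_not_mem_range
  resBondY_apply resBondY_comp_extBondY levY geo9K_dist_lab_of_qK_ne_zero)
open Node00.OpsYNablaBridge (chartY)

variable {d ℓ : ℕ} {hd : 1 ≤ d + 1} {hL : Odd (ℓ + 1) ∧ 1 < ℓ + 1} {b₀ b₁ : ℝ}
variable {𝔸 : Type} [NormedRing 𝔸] [NormedAlgebra ℂ 𝔸] [CompleteSpace 𝔸]
variable {ι : Type} [Fintype ι]
variable (i : KIdx d ℓ hd hL b₀ b₁) (parB : BondParY 𝔸 i) (b : Module.Basis ι ℝ 𝔸)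

/-! ## §1 The `ℓ²` letters: the block volume symmetrized -/

section Letters

/-- `√vol(ι)`. [cite: Balaban1985BackgroundPropagators, (3.13) p.393, dictionary] -/
def sqv (κ : IBondY i) : ℝ := Real.sqrt (volY i κ)

omit [NormedRing 𝔸] [NormedAlgebra ℂ 𝔸] [CompleteSpace 𝔸] [Fintype ι] in
/-- `√vol ≥ 0`. [cite: Balaban1985BackgroundPropagators, (3.13) p.393, bookkeeping] -/
theorem sqv_nonneg (κ : IBondY i) : 0 ≤ sqv i κ := Real.sqrt_nonneg _

omit [NormedRing 𝔸] [NormedAlgebra ℂ 𝔸] [CompleteSpace 𝔸] [Fintype ι] in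
/-- `√vol·√vol = vol`. [cite: Balaban1985BackgroundPropagators, (3.13) p.393, bookkeeping] -/
theorem sqv_mul_sqv (κ : IBondY i) : sqv i κ * sqv i κ = volY i κ := Real.mul_self_sqrt (volY_pos i κ).le

/-- **`Qb2 = ext ∘ √vol ∘ Q(U)`** on `𝔸`-valued bond functions. [cite: Balaban1985BackgroundPropagators, (3.12)–(3.13) p.393; Balaban1984PropagatorsII, (2.20) p.226] -/
def QbY2 (U : CfgY 𝔸 i) : Module.End ℂ (FBondY i → 𝔸) :=
  extBondY i ∘ₗ liftMatY 𝔸 (Matrix.diagonal (sqv i)) ∘ₗ QY i parB U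

/-- **`Qsb2 = Q*(U) ∘ √vol ∘ res`**. [cite: Balaban1985BackgroundPropagators, (3.13) p.393; Balaban1984PropagatorsII, (2.19) p.226] -/
def QsbY2 (U : CfgY 𝔸 i) : Module.End ℂ (FBondY i → 𝔸) :=
  QsY i parB U ∘ₗ liftMatY 𝔸 (Matrix.diagonal (sqv i)) ∘ₗ resBondY i

/-- `Qb2` in real bond coordinates at a coded configuration (at its decoding). [cite: Balaban1985BackgroundPropagators, (3.12) p.393, (3.26) p.395] -/
def QbC2 (c : CCfg (CfgY 𝔸 i) (AfldY 𝔸 i)) : Module.End ℝ ((Fin (d + 1) × SiteY i) × ι → ℝ) :=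
  conj b ((Node00.bondOpCoordsY i (QbY2 i parB (decY i c))).restrictScalars ℝ)

/-- `Qsb2` in real bond coordinates. [cite: Balaban1985BackgroundPropagators, (3.13) p.393, (3.26) p.395] -/
def QsbC2 (c : CCfg (CfgY 𝔸 i) (AfldY 𝔸 i)) : Module.End ℝ ((Fin (d + 1) × SiteY i) × ι → ℝ) :=
  conj b ((Node00.bondOpCoordsY i (QsbY2 i parB (decY i c))).restrictScalars ℝ)

/-- `F₂2(A) = Qb2(U′U) − Qb2(U)` at a (base, multiplier) pair, `0` elsewhere. [cite: Balaban1985BackgroundPropagators, (3.80) p.406] -/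
def F₂C2 : CCfg (CfgY 𝔸 i) (AfldY 𝔸 i) → CCfg (CfgY 𝔸 i) (AfldY 𝔸 i) → Module.End ℝ ((Fin (d + 1) × SiteY i) × ι → ℝ)
  | .base U, .mult a => QbC2 i parB b (.prod U a) - QbC2 i parB b (.base U)
  | _, _ => 0

/-- `F₂*2(A) = Qsb2(U′U) − Qsb2(U)`. [cite: Balaban1985BackgroundPropagators, (3.80) p.406] -/
def F₂sC2 : CCfg (CfgY 𝔸 i) (AfldY 𝔸 i) → CCfg (CfgY 𝔸 i) (AfldY 𝔸 i) → Module.End ℝ ((Fin (d + 1) × SiteY i) × ι → ℝ)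
  | .base U, .mult a => QsbC2 i parB b (.prod U a) - QsbC2 i parB b (.base U)
  | _, _ => 0

/-- (3.80) at the new letters: `Qb2(e^{iηa}U) = Qb2(U) + F₂2(a)`. [cite: Balaban1985BackgroundPropagators, (3.80) p.406] -/
theorem qbC2_prod (U : CfgY 𝔸 i) (a : AfldY 𝔸 i) : QbC2 i parB b (.prod U a) = QbC2 i parB b (.base U) + F₂C2 i parB b (.base U) (.mult a) := by
  simp only [F₂C2, add_sub_cancel]

/-- (3.80), second half: `Qsb2(e^{iηa}U) = Qsb2(U) + F₂*2(a)`. [cite: Balaban1985BackgroundPropagators, (3.80) p.406] -/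
theorem qsbC2_prod (U : CfgY 𝔸 i) (a : AfldY 𝔸 i) : QsbC2 i parB b (.prod U a) = QsbC2 i parB b (.base U) + F₂sC2 i parB b (.base U) (.mult a) := by
  simp only [F₂sC2, add_sub_cancel]

end Letters

/-! ## §2 The product identity: the concrete `Δ_a` is the same at the two letter systems -/

section Product

omit [CompleteSpace 𝔸] [Fintype ι] in
/-- diagonal lifts compose to the diagonal lift of the product. [cite: Balaban1985BackgroundPropagators, (3.26) p.395, bookkeeping] -/
theorem liftMatY_diagonal_comp [DecidableEq (IBondY i)] (u v : IBondY i → ℝ) :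
    liftMatY 𝔸 (Matrix.diagonal u) ∘ₗ liftMatY 𝔸 (Matrix.diagonal v) = liftMatY 𝔸 (Matrix.diagonal (u * v)) := by
  apply LinearMap.ext; intro g; funext κ
  rw [LinearMap.comp_apply, liftMatY_diagonal_apply, liftMatY_diagonal_apply, liftMatY_diagonal_apply, smul_smul, ← Complex.ofReal_mul, Pi.mul_apply]

omit [CompleteSpace 𝔸] [Fintype ι] in
/-- right-nested form of `liftMatY_diagonal_comp`. [cite: Balaban1985BackgroundPropagators, (3.26) p.395, bookkeeping] -/
theorem liftMatY_diagonal_comp_comp [DecidableEq (IBondY i)] (u v : IBondY i → ℝ) (S : (FBondY i → 𝔸) →ₗ[ℂ] (IBondY i → 𝔸)) :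
    liftMatY 𝔸 (Matrix.diagonal u) ∘ₗ (liftMatY 𝔸 (Matrix.diagonal v) ∘ₗ S) = liftMatY 𝔸 (Matrix.diagonal (u * v)) ∘ₗ S := by
  rw [← LinearMap.comp_assoc, liftMatY_diagonal_comp]

/-- ★ **THE PRODUCT IDENTITY ON `𝔸`-VALUED BOND FUNCTIONS**: `QsbY2 ∘ abVY ∘ QbY2 = QsbVY ∘ abVY ∘ QbY` (`res ∘ ext = id`, `√v·(w∕v)·√v = v·(w∕v)`).
[cite: Balaban1985BackgroundPropagators, (3.26) p.395 («Q*aQ»), (3.12)–(3.13) p.393] -/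
theorem qY2_prod (U : CfgY 𝔸 i) : QsbY2 i parB U ∘ₗ abVY (𝔸 := 𝔸) i ∘ₗ QbY2 i parB U = QsbVY i parB U ∘ₗ abVY (𝔸 := 𝔸) i ∘ₗ QbY i parB U := by
  classical
  simp only [QsbY2, QbY2, QsbVY, abVY, QbY, LinearMap.comp_assoc]
  -- cancel `res ∘ ext` (twice on the left, once on the right) and merge the diagonals
  have e2 : ∀ (w : IBondY i → ℝ) (S : (FBondY i → 𝔸) →ₗ[ℂ] (IBondY i → 𝔸)),
      resBondY (𝔸 := 𝔸) i ∘ₗ (extBondY i ∘ₗ (liftMatY 𝔸 (Matrix.diagonal w) ∘ₗ S)) = liftMatY 𝔸 (Matrix.diagonal w) ∘ₗ S := fun w S => by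
    rw [← LinearMap.comp_assoc, resBondY_comp_extBondY]; rfl
  have e3 : resBondY (𝔸 := 𝔸) i ∘ₗ (extBondY i ∘ₗ QY i parB U) = QY i parB U := by
    rw [← LinearMap.comp_assoc, resBondY_comp_extBondY]; rfl
  have hfun : (sqv i * fun κ => i.w κ / volY i κ) * sqv i = volY i * fun κ => i.w κ / volY i κ := by
    funext κ
    simp only [Pi.mul_apply, sqv]
    rw [mul_comm (Real.sqrt (volY i κ)) (i.w κ / volY i κ), mul_assoc, Real.mul_self_sqrt (volY_pos i κ).le, mul_comm]
  rw [e2, e2, e2, e3, liftMatY_diagonal_comp_comp, liftMatY_diagonal_comp_comp, liftMatY_diagonal_comp_comp, hfun]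

/-- the same in the ring `Module.End`. [cite: Balaban1985BackgroundPropagators, (3.26) p.395, bookkeeping] -/
theorem qY2_prod_mul (U : CfgY 𝔸 i) : QsbY2 i parB U * abVY (𝔸 := 𝔸) i * QbY2 i parB U = QsbVY i parB U * abVY (𝔸 := 𝔸) i * QbY i parB U := by
  simp only [Module.End.mul_eq_comp, LinearMap.comp_assoc]
  exact qY2_prod i parB U

/-- ★ **THE PRODUCT IDENTITY AT THE conj-`b` LETTERS**: `QsbC2·abC·QbC2 = QsbC·abC·QbC` at every coded configuration (the law `q2_prod` of `L2GFrame₈`).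
[cite: Balaban1985BackgroundPropagators, (3.26) p.395] -/
theorem qC2_prod (c : CCfg (CfgY 𝔸 i) (AfldY 𝔸 i)) : QsbC2 i parB b c * abC (𝔸 := 𝔸) i b * QbC2 i parB b c = QsbC i parB b c * abC (𝔸 := 𝔸) i b * QbC i parB b c := by
  rw [QsbC2, QbC2, QsbC, QbC, abC, ← B9Eq352DivFormLetters.conj_mul, ← B9Eq352DivFormLetters.conj_mul, ← B9Eq352DivFormLetters.conj_mul,
    ← B9Eq352DivFormLetters.conj_mul, ← restrictScalars_mul', ← restrictScalars_mul', ← restrictScalars_mul', ← restrictScalars_mul',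
    ← Node00.bondOpCoordsY_mul, ← Node00.bondOpCoordsY_mul, ← Node00.bondOpCoordsY_mul, ← Node00.bondOpCoordsY_mul, qY2_prod_mul]

end Product

/-! ## §3 Schur tools on print's averaging kernels: the representative reindexing, the volume-weighted column sum -/

section Schur

variable (ιB : BlkY i → IBondY i)

omit [NormedRing 𝔸] [NormedAlgebra ℂ 𝔸] [CompleteSpace 𝔸] [Fintype ι] in
/-- the indicator of the labelled block `y` at a bond of that block. [cite: Balaban1985BackgroundPropagators, (3.46) p.398 («h»), bookkeeping] -/
theorem indB_of_eq {y : IBondY i} {q : FBondY i} (h : ιB (blkV1 i.hN i.D q) = y) : indB i ιB y q = 1 := by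
  unfold indB; rw [if_pos h]

omit [NormedRing 𝔸] [NormedAlgebra ℂ 𝔸] [CompleteSpace 𝔸] [Fintype ι] in
/-- the indicator of the labelled block `y` off that block. [cite: Balaban1985BackgroundPropagators, (3.46) p.398 («h»), bookkeeping] -/
theorem indB_of_ne {y : IBondY i} {q : FBondY i} (h : ιB (blkV1 i.hN i.D q) ≠ y) : indB i ιB y q = 0 := by
  unfold indB; rw [if_neg h]

omit [NormedRing 𝔸] [NormedAlgebra ℂ 𝔸] [CompleteSpace 𝔸] [Fintype ι] in
/-- a sum over fine bonds of a function vanishing off the representatives IS the sum over index bonds (injectivity of `rep`).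
[cite: Balaban1985BackgroundPropagators, (3.13) p.393, bookkeeping] -/
theorem sum_eq_sum_repBondY (F : FBondY i → ℝ) (hF : ∀ q, q ∉ Set.range (repBondY i) → F q = 0) : ∑ q, F q = ∑ κ, F (repBondY i κ) := by
  classical
  rw [← Finset.sum_image (f := F) (repBondY_injective i).injOn]
  symm
  refine Finset.sum_subset (Finset.subset_univ _) fun q _ hq => hF q fun ⟨κ, hκ⟩ => hq ?_
  exact Finset.mem_image.2 ⟨κ, Finset.mem_univ _, hκ⟩

omit [NormedRing 𝔸] [NormedAlgebra ℂ 𝔸] [CompleteSpace 𝔸] [Fintype ι] in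
/-- a nonnegative function summed over the representatives is below its sum over all fine bonds. [cite: Balaban1985BackgroundPropagators, (3.13) p.393, bookkeeping] -/
theorem sum_comp_repBondY_le (F : FBondY i → ℝ) (hF : ∀ q, 0 ≤ F q) : ∑ κ, F (repBondY i κ) ≤ ∑ q, F q := by
  classical
  rw [← Finset.sum_image (f := F) (repBondY_injective i).injOn]
  exact Finset.sum_le_sum_of_subset_of_nonneg (Finset.subset_univ _) fun q _ _ => hF q

omit [NormedRing 𝔸] [NormedAlgebra ℂ 𝔸] [CompleteSpace 𝔸] [Fintype ι] in
/-- ★ **THE VOLUME-WEIGHTED COLUMN SUM OF THE AVERAGING KERNEL: `Σ_κ vol(κ)·|Q(κ,f)| ≦ 2L^{d+1}`** — only index bonds of levels `j₀(f)`, `j₀(f)+1` average `f`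
(`vol ≦ (L^{d+1})^{j₀+1}`), and `Σ_κ |Q(κ,f)| ≦ 2(L^{d+1})^{−j₀}`. [cite: Balaban1984PropagatorsII, (2.3)–(2.4) p.224, (2.20) p.226; Balaban1985BackgroundPropagators, (3.13)–(3.15) p.393] -/
theorem sum_vol_abs_qK_le (f : FBondY i) : ∑ κ, volY i κ * |qK i κ f| ≤ 2 * (((ℓ + 1 : ℕ) : ℝ)) ^ (d + 1) := by
  set LL : ℝ := (((ℓ + 1 : ℕ) : ℝ)) ^ (d + 1) with hLL
  set J₀ : ℕ := levY i (chartY i f.src) with hJ₀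
  have hL0 : (0 : ℝ) < LL := by positivity
  have hterm : ∀ κ, volY i κ * |qK i κ f| ≤ LL ^ (J₀ + 1) * |qsK i f κ| := by
    intro κ
    rw [qsK_eq_transpose, Matrix.transpose_apply]
    by_cases hq : qK i κ f = 0
    · rw [hq, abs_zero, mul_zero, mul_zero]
    · exact mul_le_mul_of_nonneg_right (volY_le_of_qK_ne_zero i hq) (abs_nonneg _)
  have hcol : ∑ κ, |qsK i f κ| ≤ 2 * (LL ^ J₀)⁻¹ := sum_abs_qsK_le i f
  calc ∑ κ, volY i κ * |qK i κ f| ≤ ∑ κ, LL ^ (J₀ + 1) * |qsK i f κ| := Finset.sum_le_sum fun κ _ => hterm κ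
    _ = LL ^ (J₀ + 1) * ∑ κ, |qsK i f κ| := by rw [Finset.mul_sum]
    _ ≤ LL ^ (J₀ + 1) * (2 * (LL ^ J₀)⁻¹) := mul_le_mul_of_nonneg_left hcol (by positivity)
    _ = 2 * LL := by rw [pow_succ]; field_simp

omit [CompleteSpace 𝔸] [Fintype ι] in
/-- the values of a product-form input with `‖E‖ ≦ 1`. [cite: Balaban1985BackgroundPropagators, (3.39) p.397, bookkeeping] -/
theorem norm_liftY_apply_le {J : FBondY i → ℝ} {E : 𝔸} (hE : ‖E‖ ≤ 1) (f : FBondY i) : ‖liftY J E f‖ ≤ |J f| := by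
  rw [liftY_apply]; exact norm_real_smul_le hE

omit [CompleteSpace 𝔸] in
/-- ★★ **SCHUR's TEST, `Q` SIDE**: an `ℝ`-letter `T` of `𝔸`-valued bond functions vanishing off the representatives, with `‖(TΛ)(rep κ)‖ ≦ √vol(κ)·c·Σ_f
|Q(κ,f)|·‖Λ(f)‖`, satisfies for `J ⊗ E` (`‖E‖ ≦ 1`, `J` supported in the labelled block `y′`) the block-`ℓ²` bound `‖1_{Δ(y)}·T(J ⊗ E)‖₂ ≦ c·√(2L^{d+1})·e^{δ(ℓ+3)}·
e^{−δ·d(y,y′)}·‖J‖₂` (`δ ≥ 0`): rows of `|Q|` sum to `1`, volume-weighted columns to `≦ 2L^{d+1}`, the stencil of `κ` lies within `ℓ + 3` of its block.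
[cite: Balaban1985BackgroundPropagators, (3.12)–(3.15) p.393; Balaban1984PropagatorsII, (2.20) p.226, Prop. 2.6 (2.140) p.247] -/
theorem l2_indB_le_of_avg (hι : ∀ s : BlkY i, β i.hN i.D i.hk (ιB s) = s) {T : Module.End ℝ (FBondY i → 𝔸)} {c : ℝ} (hc : 0 ≤ c)
    (hoffT : ∀ (Λ : FBondY i → 𝔸) (q : FBondY i), q ∉ Set.range (repBondY i) → T Λ q = 0)
    (hrep : ∀ (Λ : FBondY i → 𝔸) (κ : IBondY i), ‖T Λ (repBondY i κ)‖ ≤ sqv i κ * (c * ∑ f, |qK i κ f| * ‖Λ f‖))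
    {δ : ℝ} (hδ : 0 ≤ δ) (J : FBondY i → ℝ) (E : 𝔸) (y y' : IBondY i) (hE : ‖E‖ ≤ 1) (hJ : ∀ q, ιB (blkV1 i.hN i.D q) ≠ y' → J q = 0) :
    l2OfY (indB i ιB y) (T (liftY J E)) ≤ c * Real.sqrt (2 * (((ℓ + 1 : ℕ) : ℝ)) ^ (d + 1)) *
      (Real.exp (δ * ((ℓ : ℝ) + 3)) * Real.exp (-(δ * (geo9K i).dist y y'))) * (geo9K i).l2Norm (.inr J) := by
  classical
  set Λ : FBondY i → 𝔸 := liftY J E with hΛ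
  set LL : ℝ := (((ℓ + 1 : ℕ) : ℝ)) ^ (d + 1) with hLL
  set ex : ℝ := Real.exp (δ * ((ℓ : ℝ) + 3)) * Real.exp (-(δ * (geo9K i).dist y y')) with hex
  have hLL0 : (0 : ℝ) ≤ 2 * LL := by positivity
  have hex0 : 0 ≤ ex := by positivity
  have hΛf : ∀ f, ‖Λ f‖ ≤ |J f| := fun f => norm_liftY_apply_le i hE f
  have hK2 : ∀ s e : ℝ, 0 ≤ s → (c * Real.sqrt s * e) ^ 2 = c ^ 2 * s * e ^ 2 := fun s e hs => by
    rw [mul_pow, mul_pow, Real.sq_sqrt hs]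
  -- the volume-weighted column bound, with the indicator
  have hA : ∀ f, c ^ 2 * ∑ κ, indB i ιB y (repBondY i κ) * (volY i κ * |qK i κ f|) ≤ c ^ 2 * (2 * LL) := fun f => by
    refine mul_le_mul_of_nonneg_left ((Finset.sum_le_sum fun κ _ => ?_).trans (sum_vol_abs_qK_le i f)) (sq_nonneg c)
    have h01 := indB_nonneg_le_one i ιB y (repBondY i κ)
    have h0 : 0 ≤ volY i κ * |qK i κ f| := mul_nonneg (volY_pos i κ).le (abs_nonneg _)
    nlinarith
  -- pointwise in `κ`: Cauchy–Schwarz with the probability weights `|Q(κ,·)|`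
  have hpt : ∀ κ, (indB i ιB y (repBondY i κ) * ‖T Λ (repBondY i κ)‖) ^ 2 ≤
      indB i ιB y (repBondY i κ) * (c ^ 2 * ∑ f, volY i κ * |qK i κ f| * J f ^ 2) := by
    intro κ
    by_cases hy : ιB (blkV1 i.hN i.D (repBondY i κ)) = y
    · rw [indB_of_eq i ιB hy, one_mul, one_mul]
      have hsum1 : ∑ f, |qK i κ f| = 1 := sum_abs_qK_eq_one i κ
      have hCS : (∑ f, |qK i κ f| * |J f|) ^ 2 ≤ (∑ f, |qK i κ f|) * ∑ f, |qK i κ f| * J f ^ 2 :=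
        Finset.sum_sq_le_sum_mul_sum_of_sq_le_mul _ (fun f _ => abs_nonneg _) (fun f _ => mul_nonneg (abs_nonneg _) (sq_nonneg _))
          fun f _ => by rw [mul_pow, sq_abs (J f)]; exact le_of_eq (by ring)
      have hn' : ‖T Λ (repBondY i κ)‖ ≤ sqv i κ * (c * ∑ f, |qK i κ f| * |J f|) :=
        (hrep Λ κ).trans (mul_le_mul_of_nonneg_left (mul_le_mul_of_nonneg_left
          (Finset.sum_le_sum fun f _ => mul_le_mul_of_nonneg_left (hΛf f) (abs_nonneg _)) hc) (sqv_nonneg i κ))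
      have hM0 : 0 ≤ sqv i κ * (c * ∑ f, |qK i κ f| * |J f|) :=
        mul_nonneg (sqv_nonneg i κ) (mul_nonneg hc (Finset.sum_nonneg fun f _ => by positivity))
      calc ‖T Λ (repBondY i κ)‖ ^ 2 ≤ (sqv i κ * (c * ∑ f, |qK i κ f| * |J f|)) ^ 2 := pow_le_pow_left₀ (norm_nonneg _) hn' 2
        _ = volY i κ * c ^ 2 * (∑ f, |qK i κ f| * |J f|) ^ 2 := by rw [mul_pow, mul_pow, pow_two (sqv i κ), sqv_mul_sqv]; ring
        _ ≤ volY i κ * c ^ 2 * ((∑ f, |qK i κ f|) * ∑ f, |qK i κ f| * J f ^ 2) :=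
            mul_le_mul_of_nonneg_left hCS (mul_nonneg (volY_pos i κ).le (sq_nonneg _))
        _ = c ^ 2 * ∑ f, volY i κ * |qK i κ f| * J f ^ 2 := by
            rw [hsum1, one_mul, Finset.mul_sum, Finset.mul_sum]
            exact Finset.sum_congr rfl fun f _ => by ring
    · rw [indB_of_ne i ιB hy, zero_mul, zero_mul, zero_pow two_ne_zero]
  -- the sum of squares
  have hS : ∑ q, (indB i ιB y q * ‖T Λ q‖) ^ 2 ≤ (c * Real.sqrt (2 * LL) * ex) ^ 2 * ∑ q, J q ^ 2 := by
    rw [sum_eq_sum_repBondY i (fun q => (indB i ιB y q * ‖T Λ q‖) ^ 2) fun q hq => by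
      rw [hoffT Λ q hq, norm_zero, mul_zero, zero_pow two_ne_zero]]
    calc ∑ κ, (indB i ιB y (repBondY i κ) * ‖T Λ (repBondY i κ)‖) ^ 2
        ≤ ∑ κ, indB i ιB y (repBondY i κ) * (c ^ 2 * ∑ f, volY i κ * |qK i κ f| * J f ^ 2) := Finset.sum_le_sum fun κ _ => hpt κ
      _ = ∑ f, J f ^ 2 * (c ^ 2 * ∑ κ, indB i ιB y (repBondY i κ) * (volY i κ * |qK i κ f|)) := by
          simp only [Finset.mul_sum]
          rw [Finset.sum_comm]
          exact Finset.sum_congr rfl fun f _ => Finset.sum_congr rfl fun κ _ => by ring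
      _ ≤ ∑ f, J f ^ 2 * (c ^ 2 * (2 * LL) * ex ^ 2) := Finset.sum_le_sum fun f _ => ?_
      _ = (c * Real.sqrt (2 * LL) * ex) ^ 2 * ∑ q, J q ^ 2 := by rw [hK2 (2 * LL) ex hLL0, ← Finset.sum_mul, mul_comm]
    -- the per-bond factor
    by_cases hJf : J f = 0
    · rw [hJf, zero_pow two_ne_zero, zero_mul, zero_mul]
    · have hyf : ιB (blkV1 i.hN i.D f) = y' := not_not.1 (mt (hJ f) hJf)
      refine mul_le_mul_of_nonneg_left ?_ (sq_nonneg _)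
      by_cases hex' : ∃ κ, ιB (blkV1 i.hN i.D (repBondY i κ)) = y ∧ qK i κ f ≠ 0
      · obtain ⟨κ, hκy, hq⟩ := hex'
        have hdist : (geo9K i).dist y y' ≤ (ℓ : ℝ) + 3 := by
          rw [← hκy, ← hyf]; exact geo9K_dist_lab_of_qK_ne_zero i ιB hι hq
        have h1 : 1 ≤ ex ^ 2 := one_le_pow₀ (one_le_exp_mul_exp_neg hδ hdist)
        calc c ^ 2 * ∑ κ, indB i ιB y (repBondY i κ) * (volY i κ * |qK i κ f|) ≤ c ^ 2 * (2 * LL) := hA f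
          _ = c ^ 2 * (2 * LL) * 1 := (mul_one _).symm
          _ ≤ c ^ 2 * (2 * LL) * ex ^ 2 := mul_le_mul_of_nonneg_left h1 (by positivity)
      · have h0 : ∑ κ, indB i ιB y (repBondY i κ) * (volY i κ * |qK i κ f|) = 0 := Finset.sum_eq_zero fun κ _ => by
          by_cases hy : ιB (blkV1 i.hN i.D (repBondY i κ)) = y
          · have hq : qK i κ f = 0 := by by_contra hq; exact hex' ⟨κ, hy, hq⟩
            rw [hq, abs_zero, mul_zero, mul_zero]
          · rw [indB_of_ne i ιB hy, zero_mul]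
        rw [h0, mul_zero]; positivity
  -- the square roots
  have hK0 : 0 ≤ c * Real.sqrt (2 * LL) * ex := by positivity
  rw [l2OfY, l2NormB_eq]
  calc Real.sqrt (∑ q, (indB i ιB y q * ‖T Λ q‖) ^ 2) ≤ Real.sqrt ((c * Real.sqrt (2 * LL) * ex) ^ 2 * ∑ q, J q ^ 2) := Real.sqrt_le_sqrt hS
    _ = c * Real.sqrt (2 * LL) * ex * Real.sqrt (∑ q, J q ^ 2) := by rw [Real.sqrt_mul (sq_nonneg _), Real.sqrt_sq hK0]

omit [CompleteSpace 𝔸] in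
/-- ★★ **SCHUR's TEST, `Q*` SIDE**: an `ℝ`-letter `T` with `‖(TΛ)(q)‖ ≦ c·Σ_κ |Q(κ,q)|·√vol(κ)·‖Λ(rep κ)‖` satisfies the same block-`ℓ²` bound
`‖1_{Δ(y)}·T(J ⊗ E)‖₂ ≦ c·√(2L^{d+1})·e^{δ(ℓ+3)}·e^{−δ·d(y,y′)}·‖J‖₂`. [cite: Balaban1985BackgroundPropagators, (3.13)–(3.15) p.393; Balaban1984PropagatorsII, (2.19)–(2.20) p.226, Prop. 2.6 (2.140) p.247] -/
theorem l2_indB_le_of_adjAvg (hι : ∀ s : BlkY i, β i.hN i.D i.hk (ιB s) = s) {T : Module.End ℝ (FBondY i → 𝔸)} {c : ℝ} (hc : 0 ≤ c)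
    (hT : ∀ (Λ : FBondY i → 𝔸) (q : FBondY i), ‖T Λ q‖ ≤ c * ∑ κ, |qK i κ q| * (sqv i κ * ‖Λ (repBondY i κ)‖))
    {δ : ℝ} (hδ : 0 ≤ δ) (J : FBondY i → ℝ) (E : 𝔸) (y y' : IBondY i) (hE : ‖E‖ ≤ 1) (hJ : ∀ q, ιB (blkV1 i.hN i.D q) ≠ y' → J q = 0) :
    l2OfY (indB i ιB y) (T (liftY J E)) ≤ c * Real.sqrt (2 * (((ℓ + 1 : ℕ) : ℝ)) ^ (d + 1)) *
      (Real.exp (δ * ((ℓ : ℝ) + 3)) * Real.exp (-(δ * (geo9K i).dist y y'))) * (geo9K i).l2Norm (.inr J) := by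
  classical
  set Λ : FBondY i → 𝔸 := liftY J E with hΛ
  set LL : ℝ := (((ℓ + 1 : ℕ) : ℝ)) ^ (d + 1) with hLL
  set ex : ℝ := Real.exp (δ * ((ℓ : ℝ) + 3)) * Real.exp (-(δ * (geo9K i).dist y y')) with hex
  have hLL0 : (0 : ℝ) ≤ 2 * LL := by positivity
  have hex0 : 0 ≤ ex := by positivity
  have hΛf : ∀ f, ‖Λ f‖ ≤ |J f| := fun f => norm_liftY_apply_le i hE f
  have hK2 : ∀ s e : ℝ, 0 ≤ s → (c * Real.sqrt s * e) ^ 2 = c ^ 2 * s * e ^ 2 := fun s e hs => by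
    rw [mul_pow, mul_pow, Real.sq_sqrt hs]
  -- pointwise in `q`: Cauchy–Schwarz with the weights `|Q(κ,q)|` against `vol`
  have hpt : ∀ q, (indB i ιB y q * ‖T Λ q‖) ^ 2 ≤ indB i ιB y q * (c ^ 2 * (2 * LL) * ∑ κ, |qK i κ q| * J (repBondY i κ) ^ 2) := by
    intro q
    by_cases hy : ιB (blkV1 i.hN i.D q) = y
    · rw [indB_of_eq i ιB hy, one_mul, one_mul]
      have hn' : ‖T Λ q‖ ≤ c * ∑ κ, |qK i κ q| * (sqv i κ * |J (repBondY i κ)|) :=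
        (hT Λ q).trans (mul_le_mul_of_nonneg_left (Finset.sum_le_sum fun κ _ =>
          mul_le_mul_of_nonneg_left (mul_le_mul_of_nonneg_left (hΛf _) (sqv_nonneg i κ)) (abs_nonneg _)) hc)
      have hCS : (∑ κ, |qK i κ q| * (sqv i κ * |J (repBondY i κ)|)) ^ 2 ≤
          (∑ κ, |qK i κ q| * volY i κ) * ∑ κ, |qK i κ q| * J (repBondY i κ) ^ 2 :=
        Finset.sum_sq_le_sum_mul_sum_of_sq_le_mul _ (fun κ _ => mul_nonneg (abs_nonneg _) (volY_pos i κ).le)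
          (fun κ _ => mul_nonneg (abs_nonneg _) (sq_nonneg _)) fun κ _ => by
            rw [mul_pow, mul_pow, sq_abs (J _), pow_two (sqv i κ), sqv_mul_sqv]; exact le_of_eq (by ring)
      have hcolv : ∑ κ, |qK i κ q| * volY i κ ≤ 2 * LL :=
        le_of_eq_of_le (Finset.sum_congr rfl fun κ _ => mul_comm _ _) (sum_vol_abs_qK_le i q)
      have hM0 : 0 ≤ c * ∑ κ, |qK i κ q| * (sqv i κ * |J (repBondY i κ)|) :=
        mul_nonneg hc (Finset.sum_nonneg fun κ _ => mul_nonneg (abs_nonneg _) (mul_nonneg (sqv_nonneg i κ) (abs_nonneg _)))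
      have hG0 : 0 ≤ ∑ κ, |qK i κ q| * J (repBondY i κ) ^ 2 := Finset.sum_nonneg fun κ _ => mul_nonneg (abs_nonneg _) (sq_nonneg _)
      calc ‖T Λ q‖ ^ 2 ≤ (c * ∑ κ, |qK i κ q| * (sqv i κ * |J (repBondY i κ)|)) ^ 2 := pow_le_pow_left₀ (norm_nonneg _) hn' 2
        _ = c ^ 2 * (∑ κ, |qK i κ q| * (sqv i κ * |J (repBondY i κ)|)) ^ 2 := mul_pow _ _ _
        _ ≤ c ^ 2 * ((∑ κ, |qK i κ q| * volY i κ) * ∑ κ, |qK i κ q| * J (repBondY i κ) ^ 2) := mul_le_mul_of_nonneg_left hCS (sq_nonneg _)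
        _ ≤ c ^ 2 * ((2 * LL) * ∑ κ, |qK i κ q| * J (repBondY i κ) ^ 2) :=
            mul_le_mul_of_nonneg_left (mul_le_mul_of_nonneg_right hcolv hG0) (sq_nonneg _)
        _ = c ^ 2 * (2 * LL) * ∑ κ, |qK i κ q| * J (repBondY i κ) ^ 2 := by ring
    · rw [indB_of_ne i ιB hy, zero_mul, zero_mul, zero_pow two_ne_zero]
  have hS : ∑ q, (indB i ιB y q * ‖T Λ q‖) ^ 2 ≤ (c * Real.sqrt (2 * LL) * ex) ^ 2 * ∑ q, J q ^ 2 := by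
    calc ∑ q, (indB i ιB y q * ‖T Λ q‖) ^ 2
        ≤ ∑ q, indB i ιB y q * (c ^ 2 * (2 * LL) * ∑ κ, |qK i κ q| * J (repBondY i κ) ^ 2) := Finset.sum_le_sum fun q _ => hpt q
      _ = ∑ κ, J (repBondY i κ) ^ 2 * (c ^ 2 * (2 * LL) * ∑ q, indB i ιB y q * |qK i κ q|) := by
          simp only [Finset.mul_sum]
          rw [Finset.sum_comm]
          exact Finset.sum_congr rfl fun κ _ => Finset.sum_congr rfl fun q _ => by ring
      _ ≤ ∑ κ, J (repBondY i κ) ^ 2 * (c ^ 2 * (2 * LL) * ex ^ 2) := Finset.sum_le_sum fun κ _ => ?_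
      _ ≤ (∑ q, J q ^ 2) * (c ^ 2 * (2 * LL) * ex ^ 2) := by
          rw [← Finset.sum_mul]
          exact mul_le_mul_of_nonneg_right (sum_comp_repBondY_le i (fun q => J q ^ 2) fun q => sq_nonneg _) (by positivity)
      _ = (c * Real.sqrt (2 * LL) * ex) ^ 2 * ∑ q, J q ^ 2 := by rw [hK2 (2 * LL) ex hLL0, mul_comm]
    by_cases hJκ : J (repBondY i κ) = 0
    · rw [hJκ, zero_pow two_ne_zero, zero_mul, zero_mul]
    · have hyκ : ιB (blkV1 i.hN i.D (repBondY i κ)) = y' := not_not.1 (mt (hJ _) hJκ)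
      refine mul_le_mul_of_nonneg_left ?_ (sq_nonneg _)
      by_cases hex' : ∃ q, ιB (blkV1 i.hN i.D q) = y ∧ qK i κ q ≠ 0
      · obtain ⟨q, hqy, hq⟩ := hex'
        have hdist : (geo9K i).dist y y' ≤ (ℓ : ℝ) + 3 := by
          rw [geo9K_dist_comm, ← hqy, ← hyκ]; exact geo9K_dist_lab_of_qK_ne_zero i ιB hι hq
        have h1 : 1 ≤ ex ^ 2 := one_le_pow₀ (one_le_exp_mul_exp_neg hδ hdist)
        have hrow : ∑ q, indB i ιB y q * |qK i κ q| ≤ 1 := by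
          calc ∑ q, indB i ιB y q * |qK i κ q| ≤ ∑ q, |qK i κ q| := Finset.sum_le_sum fun q _ => by
                  have h01 := indB_nonneg_le_one i ιB y q
                  have h0 := abs_nonneg (qK i κ q)
                  nlinarith
            _ = 1 := sum_abs_qK_eq_one i κ
        calc c ^ 2 * (2 * LL) * ∑ q, indB i ιB y q * |qK i κ q| ≤ c ^ 2 * (2 * LL) * 1 := mul_le_mul_of_nonneg_left hrow (by positivity)
          _ ≤ c ^ 2 * (2 * LL) * ex ^ 2 := mul_le_mul_of_nonneg_left h1 (by positivity)
      · have h0 : ∑ q, indB i ιB y q * |qK i κ q| = 0 := Finset.sum_eq_zero fun q _ => by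
          by_cases hy : ιB (blkV1 i.hN i.D q) = y
          · have hq : qK i κ q = 0 := by by_contra hq; exact hex' ⟨q, hy, hq⟩
            rw [hq, abs_zero, mul_zero]
          · rw [indB_of_ne i ιB hy, zero_mul]
        rw [h0, mul_zero]; positivity
  have hK0 : 0 ≤ c * Real.sqrt (2 * LL) * ex := by positivity
  rw [l2OfY, l2NormB_eq]
  calc Real.sqrt (∑ q, (indB i ιB y q * ‖T Λ q‖) ^ 2) ≤ Real.sqrt ((c * Real.sqrt (2 * LL) * ex) ^ 2 * ∑ q, J q ^ 2) := Real.sqrt_le_sqrt hS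
    _ = c * Real.sqrt (2 * LL) * ex * Real.sqrt (∑ q, J q ^ 2) := by rw [Real.sqrt_mul (sq_nonneg _), Real.sqrt_sq hK0]

end Schur

/-! ## §4 ★★ The block-`ℓ²` sizes of the `ℓ²` letters: (3.15) for `Qb2`, `Qsb2`, (3.81) for `F₂2`, `F₂s2` -/

section Sizes

variable (ιB : BlkY i → IBondY i) [Fintype (geo9K i).Site] [DecidableEq (geo9K i).Site] {Rr : ℝ} {Hp : Prop}

omit [CompleteSpace 𝔸] in
/-- ★ `Q`-side Schur datum ⇒ block-`ℓ²` majorant of `conj b (bondOpCoordsRY T)` on r06's carrier, kernel `c_L·c·√(2L^{d+1})·e^{δ(ℓ+3)}·e^{−δd}`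
(`c_L = √|ι|·M₂·Σ_j‖b_j‖`). [cite: Balaban1984PropagatorsII, Prop. 2.6 (2.140) p.247, (2.51) p.232; Balaban1985BackgroundPropagators, (3.15) p.393] -/
theorem hasL2Majorant_conj_of_avg (hι : ∀ s : BlkY i, β i.hN i.D i.hk (ιB s) = s) {M₂ : ℝ} (hM₂ : 0 ≤ M₂)
    (hrepr : ∀ (v : 𝔸) (j : ι), |b.repr v j| ≤ M₂ * ‖v‖) {T : Module.End ℝ (FBondY i → 𝔸)} {c : ℝ} (hc : 0 ≤ c)
    (hoffT : ∀ (Λ : FBondY i → 𝔸) (q : FBondY i), q ∉ Set.range (repBondY i) → T Λ q = 0)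
    (hrep : ∀ (Λ : FBondY i → 𝔸) (κ : IBondY i), ‖T Λ (repBondY i κ)‖ ≤ sqv i κ * (c * ∑ f, |qK i κ f| * ‖Λ f‖)) {δ : ℝ} (hδ : 0 ≤ δ) :
    HasL2Majorant (g := toB6 (geo9K i) Rr Hp) (fun q : (Fin (d + 1) × SiteY i) × ι => blkC i ιB q.1.2) (conj b (bondOpCoordsRY i T))
      (fun a a' => (Real.sqrt (Fintype.card ι) * M₂ * ∑ j, ‖b j‖) * (c * Real.sqrt (2 * (((ℓ + 1 : ℕ) : ℝ)) ^ (d + 1)) *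
        (Real.exp (δ * ((ℓ : ℝ) + 3)) * Real.exp (-(δ * (geo9K i).dist a a'))))) :=
  hasL2Majorant_conj_bondOpCoordsRY i b ιB T
    (hasL2Majorant_conjB_of_indBound i ιB b hM₂ hrepr Rr Hp T _ (fun a a' => by positivity) fun J E y y' hE hJ =>
      l2_indB_le_of_avg i ιB hι hc hoffT hrep hδ J E y y' hE hJ)

omit [CompleteSpace 𝔸] in
/-- ★ `Q*`-side Schur datum ⇒ block-`ℓ²` majorant of `conj b (bondOpCoordsRY T)`, the same kernel.
[cite: Balaban1984PropagatorsII, Prop. 2.6 (2.140) p.247, (2.51) p.232; Balaban1985BackgroundPropagators, (3.15) p.393] -/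
theorem hasL2Majorant_conj_of_adjAvg (hι : ∀ s : BlkY i, β i.hN i.D i.hk (ιB s) = s) {M₂ : ℝ} (hM₂ : 0 ≤ M₂)
    (hrepr : ∀ (v : 𝔸) (j : ι), |b.repr v j| ≤ M₂ * ‖v‖) {T : Module.End ℝ (FBondY i → 𝔸)} {c : ℝ} (hc : 0 ≤ c)
    (hT : ∀ (Λ : FBondY i → 𝔸) (q : FBondY i), ‖T Λ q‖ ≤ c * ∑ κ, |qK i κ q| * (sqv i κ * ‖Λ (repBondY i κ)‖)) {δ : ℝ} (hδ : 0 ≤ δ) :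
    HasL2Majorant (g := toB6 (geo9K i) Rr Hp) (fun q : (Fin (d + 1) × SiteY i) × ι => blkC i ιB q.1.2) (conj b (bondOpCoordsRY i T))
      (fun a a' => (Real.sqrt (Fintype.card ι) * M₂ * ∑ j, ‖b j‖) * (c * Real.sqrt (2 * (((ℓ + 1 : ℕ) : ℝ)) ^ (d + 1)) *
        (Real.exp (δ * ((ℓ : ℝ) + 3)) * Real.exp (-(δ * (geo9K i).dist a a'))))) :=
  hasL2Majorant_conj_bondOpCoordsRY i b ιB T
    (hasL2Majorant_conjB_of_indBound i ιB b hM₂ hrepr Rr Hp T _ (fun a a' => by positivity) fun J E y y' hE hJ =>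
      l2_indB_le_of_adjAvg i ιB hι hc hT hδ J E y y' hE hJ)

omit [Fintype (geo9K i).Site] [DecidableEq (geo9K i).Site] in
/-- `‖(Q(U)Λ)(κ)‖ ≦ Σ_f |Q(κ,f)|·‖Λ(f)‖` for contractive averaging transporters. [cite: Balaban1984PropagatorsI, (1.18) p.20; Balaban1985BackgroundPropagators, (3.12) p.393] -/
theorem norm_QY_apply_le_sum {U : CfgY 𝔸 i} (hparU : ∀ s s', ‖(parB U s s' : 𝔸)‖ ≤ 1 ∧ ‖(((parB U s s')⁻¹ : 𝔸ˣ) : 𝔸)‖ ≤ 1)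
    (Λ : FBondY i → 𝔸) (κ : IBondY i) : ‖QY i parB U Λ κ‖ ≤ ∑ f, |qK i κ f| * ‖Λ f‖ := by
  rw [QY, trLiftY_apply]
  refine (norm_sum_le _ _).trans (Finset.sum_le_sum fun f _ => ?_)
  rw [norm_smul, Complex.norm_real, Real.norm_eq_abs]
  exact mul_le_mul_of_nonneg_left (norm_R_le_of_unit _ _ (hparU _ _)) (abs_nonneg _)

/-- ★★ **THE (3.15) BLOCK-`ℓ²` MAJORANT OF `Qb2 = ext∘√vol∘Q(U)`** at a configuration with contractive averaging transporters: for every `δ ≥ 0`,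
`QbC2 parB b (base U) ≺₂ c_L·√(2L^{d+1})·e^{δ(ℓ+3)}·e^{−δ·d}`. [cite: Balaban1985BackgroundPropagators, (3.12)–(3.15) pp.392–393; Balaban1984PropagatorsII, (2.20) p.226, Prop. 2.6 (2.140) p.247] -/
theorem hasL2Majorant_QbC2 (hι : ∀ s : BlkY i, β i.hN i.D i.hk (ιB s) = s) {M₂ : ℝ} (hM₂ : 0 ≤ M₂)
    (hrepr : ∀ (v : 𝔸) (j : ι), |b.repr v j| ≤ M₂ * ‖v‖) {U : CfgY 𝔸 i}
    (hparU : ∀ s s', ‖(parB U s s' : 𝔸)‖ ≤ 1 ∧ ‖(((parB U s s')⁻¹ : 𝔸ˣ) : 𝔸)‖ ≤ 1) {δ : ℝ} (hδ : 0 ≤ δ) :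
    HasL2Majorant (g := toB6 (geo9K i) Rr Hp) (fun q : (Fin (d + 1) × SiteY i) × ι => blkC i ιB q.1.2) (QbC2 i parB b (.base U))
      (fun a a' => (Real.sqrt (Fintype.card ι) * M₂ * ∑ j, ‖b j‖) * (1 * Real.sqrt (2 * (((ℓ + 1 : ℕ) : ℝ)) ^ (d + 1)) *
        (Real.exp (δ * ((ℓ : ℝ) + 3)) * Real.exp (-(δ * (geo9K i).dist a a'))))) := by
  classical
  have hQ : QbC2 i parB b (.base U) = conj b (bondOpCoordsRY i ((QbY2 i parB U).restrictScalars ℝ)) := by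
    rw [QbC2, restrictScalars_bondOpCoordsY, decY_base]
  rw [hQ]
  refine hasL2Majorant_conj_of_avg i b ιB hι hM₂ hrepr zero_le_one (fun Λ q hq => ?_) (fun Λ κ => ?_) hδ
  · rw [LinearMap.restrictScalars_apply]
    simp only [QbY2, LinearMap.comp_apply]
    exact extBondY_apply_of_not_mem_range i _ hq
  · rw [LinearMap.restrictScalars_apply]
    simp only [QbY2, LinearMap.comp_apply, extBondY_apply_repBondY, liftMatY_diagonal_apply]
    rw [norm_smul, Complex.norm_real, Real.norm_eq_abs, abs_of_nonneg (sqv_nonneg i κ), one_mul]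
    exact mul_le_mul_of_nonneg_left (norm_QY_apply_le_sum i parB hparU Λ κ) (sqv_nonneg i κ)

/-- ★★ **THE (3.15) BLOCK-`ℓ²` MAJORANT OF `Qsb2 = Q*(U)∘√vol∘res`**: for every `δ ≥ 0`, `QsbC2 parB b (base U) ≺₂ c_L·√(2L^{d+1})·e^{δ(ℓ+3)}·e^{−δ·d}`.
[cite: Balaban1985BackgroundPropagators, (3.13)–(3.15) p.393; Balaban1984PropagatorsII, (2.19)–(2.20) p.226, Prop. 2.6 (2.140) p.247] -/
theorem hasL2Majorant_QsbC2 (hι : ∀ s : BlkY i, β i.hN i.D i.hk (ιB s) = s) {M₂ : ℝ} (hM₂ : 0 ≤ M₂)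
    (hrepr : ∀ (v : 𝔸) (j : ι), |b.repr v j| ≤ M₂ * ‖v‖) {U : CfgY 𝔸 i}
    (hparU : ∀ s s', ‖(parB U s s' : 𝔸)‖ ≤ 1 ∧ ‖(((parB U s s')⁻¹ : 𝔸ˣ) : 𝔸)‖ ≤ 1) {δ : ℝ} (hδ : 0 ≤ δ) :
    HasL2Majorant (g := toB6 (geo9K i) Rr Hp) (fun q : (Fin (d + 1) × SiteY i) × ι => blkC i ιB q.1.2) (QsbC2 i parB b (.base U))
      (fun a a' => (Real.sqrt (Fintype.card ι) * M₂ * ∑ j, ‖b j‖) * (1 * Real.sqrt (2 * (((ℓ + 1 : ℕ) : ℝ)) ^ (d + 1)) *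
        (Real.exp (δ * ((ℓ : ℝ) + 3)) * Real.exp (-(δ * (geo9K i).dist a a'))))) := by
  classical
  have hQ : QsbC2 i parB b (.base U) = conj b (bondOpCoordsRY i ((QsbY2 i parB U).restrictScalars ℝ)) := by
    rw [QsbC2, restrictScalars_bondOpCoordsY, decY_base]
  rw [hQ]
  refine hasL2Majorant_conj_of_adjAvg i b ιB hι hM₂ hrepr zero_le_one (fun Λ q => ?_) hδ
  rw [LinearMap.restrictScalars_apply, one_mul]
  simp only [QsbY2, LinearMap.comp_apply]
  rw [QsY, trLiftY_apply]
  refine (norm_sum_le _ _).trans (Finset.sum_le_sum fun κ _ => ?_)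
  rw [qsK_eq_transpose, Matrix.transpose_apply, norm_smul, Complex.norm_real, Real.norm_eq_abs, liftMatY_diagonal_apply, resBondY_apply]
  refine mul_le_mul_of_nonneg_left ?_ (abs_nonneg _)
  have h12 : ‖(qT i parB U κ q : 𝔸)‖ ≤ 1 ∧ ‖(((qT i parB U κ q)⁻¹ : 𝔸ˣ) : 𝔸)‖ ≤ 1 := hparU _ _
  refine (norm_R_le_of_unit _ _ ⟨h12.2, by rw [inv_inv]; exact h12.1⟩).trans (le_of_eq ?_)
  rw [norm_smul, Complex.norm_real, Real.norm_eq_abs, abs_of_nonneg (sqv_nonneg i κ)]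

/-- ★★ **THE (3.81) BLOCK-`ℓ²` MAJORANT OF `F₂2(A) = Qb2(e^{iηa}U) − Qb2(U)`** under the bond-transporter variation law `VarParBY` at `(U, a)` with `(c_var, β)`:
for every `δ ≥ 0`, `F₂C2 (base U) (mult a) ≺₂ c_L·(c_var β)·√(2L^{d+1})·e^{δ(ℓ+3)}·e^{−δ·d}` — print's `‖F₂(A)‖ ≦ O(1)α₁`.
[cite: Balaban1985BackgroundPropagators, (3.80)–(3.81) pp.406–407; Balaban1984PropagatorsII, Prop. 2.6 (2.140) p.247] -/
theorem hasL2Majorant_F₂C2 (hι : ∀ s : BlkY i, β i.hN i.D i.hk (ιB s) = s) {M₂ : ℝ} (hM₂ : 0 ≤ M₂)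
    (hrepr : ∀ (v : 𝔸) (j : ι), |b.repr v j| ≤ M₂ * ‖v‖) {U : CfgY 𝔸 i} {a : AfldY 𝔸 i} {cVar βv : ℝ} (hcv : 0 ≤ cVar * βv)
    (hvar : VarParBY i parB cVar βv U a) {δ : ℝ} (hδ : 0 ≤ δ) :
    HasL2Majorant (g := toB6 (geo9K i) Rr Hp) (fun q : (Fin (d + 1) × SiteY i) × ι => blkC i ιB q.1.2) (F₂C2 i parB b (.base U) (.mult a))
      (fun a a' => (Real.sqrt (Fintype.card ι) * M₂ * ∑ j, ‖b j‖) * (cVar * βv * Real.sqrt (2 * (((ℓ + 1 : ℕ) : ℝ)) ^ (d + 1)) *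
        (Real.exp (δ * ((ℓ : ℝ) + 3)) * Real.exp (-(δ * (geo9K i).dist a a'))))) := by
  classical
  set W := decY i (.prod U a) with hW
  have hQ : F₂C2 i parB b (.base U) (.mult a) = conj b (bondOpCoordsRY i ((QbY2 i parB W - QbY2 i parB U).restrictScalars ℝ)) := by
    simp only [F₂C2, QbC2, restrictScalars_bondOpCoordsY, decY_base, ← B9Eq352DivFormLetters.conj_sub, ← map_sub]
    rfl
  rw [hQ]
  refine hasL2Majorant_conj_of_avg i b ιB hι hM₂ hrepr hcv (fun Λ q hq => ?_) (fun Λ κ => ?_) hδ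
  · rw [LinearMap.restrictScalars_apply, LinearMap.sub_apply, Pi.sub_apply]
    simp only [QbY2, LinearMap.comp_apply]
    rw [extBondY_apply_of_not_mem_range i _ hq, extBondY_apply_of_not_mem_range i _ hq, sub_zero]
  · rw [LinearMap.restrictScalars_apply, LinearMap.sub_apply, Pi.sub_apply]
    simp only [QbY2, LinearMap.comp_apply, extBondY_apply_repBondY, liftMatY_diagonal_apply]
    rw [← smul_sub, norm_smul, Complex.norm_real, Real.norm_eq_abs, abs_of_nonneg (sqv_nonneg i κ)]
    refine mul_le_mul_of_nonneg_left ?_ (sqv_nonneg i κ)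
    have hval : QY i parB W Λ κ - QY i parB U Λ κ =
        ∑ f', ((qK i κ f' : ℝ) : ℂ) • (R (qT i parB W κ f') (Λ f') - R (qT i parB U κ f') (Λ f')) := by
      simp only [QY, trLiftY_apply, smul_sub, Finset.sum_sub_distrib]
    rw [hval, Finset.mul_sum]
    refine (norm_sum_le _ _).trans (Finset.sum_le_sum fun f' _ => ?_)
    by_cases hq : qK i κ f' = 0
    · rw [hq, Complex.ofReal_zero, zero_smul, norm_zero, abs_zero, zero_mul, mul_zero]
    · rw [norm_smul, Complex.norm_real, Real.norm_eq_abs]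
      calc |qK i κ f'| * ‖R (qT i parB W κ f') (Λ f') - R (qT i parB U κ f') (Λ f')‖
          ≤ |qK i κ f'| * (cVar * βv * ‖Λ f'‖) := mul_le_mul_of_nonneg_left (hvar κ f' hq (Λ f')).1 (abs_nonneg _)
        _ = cVar * βv * (|qK i κ f'| * ‖Λ f'‖) := by ring

/-- ★★ **THE (3.81) BLOCK-`ℓ²` MAJORANT OF `F₂s2(A) = Qsb2(e^{iηa}U) − Qsb2(U)`** under `VarParBY` at `(U, a)` with `(c_var, β)`: for every `δ ≥ 0`,
`F₂sC2 (base U) (mult a) ≺₂ c_L·(c_var β)·√(2L^{d+1})·e^{δ(ℓ+3)}·e^{−δ·d}`. [cite: Balaban1985BackgroundPropagators, (3.80)–(3.81) pp.406–407, (3.13) p.393; Balaban1984PropagatorsII, Prop. 2.6 (2.140) p.247] -/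
theorem hasL2Majorant_F₂sC2 (hι : ∀ s : BlkY i, β i.hN i.D i.hk (ιB s) = s) {M₂ : ℝ} (hM₂ : 0 ≤ M₂)
    (hrepr : ∀ (v : 𝔸) (j : ι), |b.repr v j| ≤ M₂ * ‖v‖) {U : CfgY 𝔸 i} {a : AfldY 𝔸 i} {cVar βv : ℝ} (hcv : 0 ≤ cVar * βv)
    (hvar : VarParBY i parB cVar βv U a) {δ : ℝ} (hδ : 0 ≤ δ) :
    HasL2Majorant (g := toB6 (geo9K i) Rr Hp) (fun q : (Fin (d + 1) × SiteY i) × ι => blkC i ιB q.1.2) (F₂sC2 i parB b (.base U) (.mult a))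
      (fun a a' => (Real.sqrt (Fintype.card ι) * M₂ * ∑ j, ‖b j‖) * (cVar * βv * Real.sqrt (2 * (((ℓ + 1 : ℕ) : ℝ)) ^ (d + 1)) *
        (Real.exp (δ * ((ℓ : ℝ) + 3)) * Real.exp (-(δ * (geo9K i).dist a a'))))) := by
  classical
  set W := decY i (.prod U a) with hW
  have hQ : F₂sC2 i parB b (.base U) (.mult a) = conj b (bondOpCoordsRY i ((QsbY2 i parB W - QsbY2 i parB U).restrictScalars ℝ)) := by
    simp only [F₂sC2, QsbC2, restrictScalars_bondOpCoordsY, decY_base, ← B9Eq352DivFormLetters.conj_sub, ← map_sub]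
    rfl
  rw [hQ]
  refine hasL2Majorant_conj_of_adjAvg i b ιB hι hM₂ hrepr hcv (fun Λ q => ?_) hδ
  rw [LinearMap.restrictScalars_apply, LinearMap.sub_apply, Pi.sub_apply]
  simp only [QsbY2, LinearMap.comp_apply]
  set g : IBondY i → 𝔸 := liftMatY 𝔸 (Matrix.diagonal (sqv i)) (resBondY i Λ) with hg
  have hgκ : ∀ κ, ‖g κ‖ = sqv i κ * ‖Λ (repBondY i κ)‖ := fun κ => by
    rw [hg, liftMatY_diagonal_apply, resBondY_apply, norm_smul, Complex.norm_real, Real.norm_eq_abs, abs_of_nonneg (sqv_nonneg i κ)]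
  have hval : QsY i parB W g q - QsY i parB U g q =
      ∑ κ, ((qsK i q κ : ℝ) : ℂ) • (R (qT i parB W κ q)⁻¹ (g κ) - R (qT i parB U κ q)⁻¹ (g κ)) := by
    simp only [QsY, trLiftY_apply, smul_sub, Finset.sum_sub_distrib]
  rw [hval, Finset.mul_sum]
  refine (norm_sum_le _ _).trans (Finset.sum_le_sum fun κ _ => ?_)
  rw [qsK_eq_transpose, Matrix.transpose_apply]
  by_cases hq : qK i κ q = 0
  · rw [hq, Complex.ofReal_zero, zero_smul, norm_zero, abs_zero, zero_mul, mul_zero]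
  · rw [norm_smul, Complex.norm_real, Real.norm_eq_abs, ← hgκ]
    calc |qK i κ q| * ‖R (qT i parB W κ q)⁻¹ (g κ) - R (qT i parB U κ q)⁻¹ (g κ)‖
        ≤ |qK i κ q| * (cVar * βv * ‖g κ‖) := mul_le_mul_of_nonneg_left (hvar κ q hq (g κ)).2 (abs_nonneg _)
      _ = cVar * βv * (|qK i κ q| * ‖g κ‖) := by ring

end Sizes

end Literature.MathematicalPhysics.QuantumFieldTheory.Balaban1983to89.B9SectBQLettersL2Y

end
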